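import Mathlib.Algebra.MvPolynomial.Derivation
import Mathlib.RingTheory.Derivation.Lie
import Literature.NumberTheory.Automorphic.LieAlgebraGLDimension
import Literature.NumberTheory.Automorphic.LieAlgebraGLStabilizer
import HarnessLib

/-!
# Invariant derivations of `k[GL_n]` and the Lie algebra of an algebraic subgroup
(trunk T-AUTOMORPHIC, G25 AutomorphicL; Springer, *Linear Algebraic Groups*, 4.4.3–4.4.10)

Companion to `LieAlgebraGL.lean` (the Lie algebra `lieAlgebraGL G ⊆ 𝔤𝔩ₙ` of a subgroup
`G ≤ GL n k`: the matrices `X` with `d p_1 (X) = 0` for all `p` in the vanishing ideal `𝓘(G)`),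
`LieAlgebraGLStabilizer.lean` (calculus at `1 + ε X`) and `LieAlgebraGLDimension.lean` (the ideal
`idealGL G = 𝓘(G)` and left translations `p ↦ p ∘ L_g`), namespace
`Literature.NumberTheory.Automorphic`, concrete `k`-points vocabulary. Springer (4.4.3) defines
the Lie algebra `L(G)` of a linear algebraic group `G` as the derivations of `k[G]` commuting with
all left translations `λ(x)`; for `G ≤ GL_n` (4.4.10 (3)) these are induced by the derivations
`D_X = ∑_{ij} (x X)_{ij} ∂/∂x_{ij} - tr(X) y ∂/∂y` (`y = det⁻¹`) of the polynomial ring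
`k[x_{ij}, y]`, `X ∈ 𝔤𝔩ₙ` — the velocity fields `(D_X p)(g) = d/ds p (g (1 + s X))|_{s=0}` of
right multiplication by `1 + s X`, which commute with the left translations (*left-invariant*
derivations, i.e. infinitesimal *right* translations, cf. `rTransGL` of `RightTranslationGL.lean`).
**Sign convention:** this `D_X` is the *negative* of Springer's `D_X` in 4.4.10 (3) (his
`D_X T_{ij} = -∑_h T_{ih} X_{hj}`, the isomorphism `Ψ` of 4.4.4 carrying a minus sign); we use the
velocity convention matching `dualPoint` / `tangentDeriv` / `lieAlgebraGL` of `LieAlgebraGL.lean`,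
under which `⁅D_X, D_Y⁆ = D_{XY - YX}`. This file provides the `D_X` and proves, with no
hypothesis on `G` or `k`:

* `rDeriv X` (**definition**, via Mathlib's `MvPolynomial.mkDerivation`) with its values
  `rDerivVal X` on the coordinates; `eval_rDeriv`: `(D_X p)(g) = d(p ∘ L_g)_1 (X)`
  (the differential `tangentDeriv` of `LieAlgebraGL.lean`);
* **`mem_lieAlgebraGL_iff_forall_rDeriv_mem`**: `X ∈ Lie(G) ↔ D_X 𝓘(G) ⊆ 𝓘(G)` (Springer 4.4.7
  with 4.4.10 (3): the Lie algebra of the closed subgroup `G ≤ GL_n` is the space of `X ∈ 𝔤𝔩ₙ`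
  whose invariant derivation preserves the ideal of `G`); hence the iterates `D_X^m` preserve `𝓘(G)`
  (`iterate_rDeriv_mem_idealGL`) — the input of the exponential theorem of `LieAlgebraGLExp.lean`;
* `X ↦ D_X` is linear and a Lie algebra homomorphism: `rDeriv_add`, `rDeriv_smul`,
  **`rDeriv_commutator`** (`⁅D_X, D_Y⁆ = D_{XY - YX}`; Springer 4.4.3, 4.4.10 (3));
* `D_X` does not raise the total degree (`rDeriv_mem_restrictTotalDegree`), so it preserves the
  finite-dimensional pieces `k[x, y]_{≤ d}` (Mathlib `MvPolynomial.restrictTotalDegree`);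
* for a diagonal `X = diag(s)` the monomials are eigenvectors of `D_X`
  (`rDeriv_diagonal_monomial`, eigenvalue `∑_c m_c w_c` with `w (x_{ij}) = s_j`, `w (y) = -∑ s_i`).

These are the inputs of the characteristic-zero theory of `LieAlgebraGLExp.lean` (exponentials of
nilpotent elements of `Lie(G)` lie in `G`), of the Jordan decomposition in `Lie(G)` and of the
algebraic hull of a semisimple element (Chevalley), used for Springer 8.1.2 / 7.6.4 (ii) at the
level of Lie algebras.

## Mathlib

`MvPolynomial.mkDerivation`, `MvPolynomial.derivation_ext`, `Derivation.leibniz`,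
`Derivation.commutator_apply`, `MvPolynomial.restrictTotalDegree`. Mathlib has no algebraic groups
and no Lie algebra of a matrix group beyond `Matrix` as a Lie ring; nothing here duplicates a
Mathlib declaration (searched `rDeriv`, `invariant derivation`, `mkDerivation` + `Matrix`).

## References

* T. A. Springer, *Linear Algebraic Groups*, 2nd ed., Progress in Mathematics 9, Birkhäuser
  (1998), 4.4.3, 4.4.4, 4.4.7, 4.4.10 (3) [SpringerLAG1998].
-/

noncomputable section

open MvPolynomial TrivSqZeroExt DualNumber

namespace Literature.NumberTheory.Automorphic

variable {k : Type*} [Field k] {n : Type*} [Fintype n] [DecidableEq n]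

/-! ### The derivations `D_X` -/

section Derivation

/-- The values of the derivation `D_X` on the coordinates: `D_X (x_{ij}) = (x X)_{ij}` and
`D_X (y) = - tr(X) y` for `y = det⁻¹` (the velocity at `s = 0` of the coordinates of
`g (1 + s X)`). This is the *negative* of Springer's `D_X` of 4.4.10 (3)
(`D_X T_{ij} = -∑_h T_{ih} X_{hj}`): we use the velocity convention of `dualPoint` /
`lieAlgebraGL`. [cite: SpringerLAG1998, 4.4.10 (3)] -/
def rDerivVal (X : Matrix n n k) : GLCoord n → MvPolynomial (GLCoord n) k
  | Sum.inl ij => ∑ l, MvPolynomial.X (Sum.inl (ij.1, l)) * C (X l ij.2)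
  | Sum.inr u => C (- Matrix.trace X) * MvPolynomial.X (Sum.inr u)

/-- The derivation `D_X = ∑_{ij} (x X)_{ij} ∂/∂x_{ij} - tr(X) y ∂/∂y` of `k[x_{ij}, y]` attached to
`X ∈ 𝔤𝔩ₙ`: the left-invariant derivation (commuting with the left translations `λ(x)`,
Springer 4.4.3), i.e. the infinitesimal right translation, `(D_X p)(g) = d/ds p (g (1 + s X))|_{s=0}`
(`eval_rDeriv`); the negative of Springer's `D_X` of 4.4.10 (3) (velocity convention).
[cite: SpringerLAG1998, 4.4.3 and 4.4.10 (3)] -/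
def rDeriv (X : Matrix n n k) :
    Derivation k (MvPolynomial (GLCoord n) k) (MvPolynomial (GLCoord n) k) :=
  MvPolynomial.mkDerivation k (rDerivVal X)

omit [DecidableEq n] in
/-- `D_X` on the coordinates. [folklore] -/
@[simp] lemma rDeriv_X (X : Matrix n n k) (c : GLCoord n) :
    rDeriv X (MvPolynomial.X c) = rDerivVal X c :=
  mkDerivation_X _ _ _

omit [DecidableEq n] in
/-- `D_X` kills constants. [folklore] -/
@[simp] lemma rDeriv_C (X : Matrix n n k) (a : k) : rDeriv X (C a) = 0 :=
  MvPolynomial.derivation_C _ _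

/-- The value `(g X)_{ij}` of `D_X (x_{ij})` at `g`. [folklore] -/
lemma eval_rDerivVal_inl (X : Matrix n n k) (g : GL n k) (i j : n) :
    eval (glCoordFun g) (rDerivVal X (Sum.inl (i, j))) = ((g : Matrix n n k) * X) i j := by
  simp [rDerivVal, Matrix.mul_apply]

/-- The value `- tr(X) det(g)⁻¹` of `D_X (y)` at `g`. [folklore] -/
lemma eval_rDerivVal_inr (X : Matrix n n k) (g : GL n k) (u : Unit) :
    eval (glCoordFun g) (rDerivVal X (Sum.inr u)) =
      - Matrix.trace X * ((g : Matrix n n k).det)⁻¹ := by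
  simp [rDerivVal]

/-- The differential at `1` of the coordinate `c` of `g x` (as a function of `x`) is the value of
`D_X (c)` at `g`: the coordinates of `g (1 + ε X)` are `(g + ε g X, det(g)⁻¹ (1 - ε tr X))`.
[folklore] -/
lemma tangentDeriv_leftMulPolyGL (g : GL n k) (X : Matrix n n k) (c : GLCoord n) :
    tangentDeriv (leftMulPolyGL g c) X = eval (glCoordFun g) (rDerivVal X c) := by
  rw [tangentDeriv, dualPoint_eq_coordsOf, aeval_leftMulPolyGL_coordsOf]
  rcases c with ⟨i, j⟩ | u
  · rw [coordsOf_inl, eval_rDerivVal_inl, dualMatrix, Matrix.mul_add, Matrix.mul_one,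
      map_algebraMap_mul_map_inr, Matrix.add_apply, Matrix.map_apply, Matrix.map_apply, snd_add,
      TrivSqZeroExt.algebraMap_eq_inl, snd_inl, snd_inr, zero_add]
  · rw [coordsOf_inr, eval_rDerivVal_inr, TrivSqZeroExt.algebraMap_eq_inl, mul_add, inl_mul_inl,
      inl_mul_inr, snd_add, snd_inl, snd_inr, zero_add, smul_eq_mul, mul_comm]

/-- **`D_X` is the left-invariant derivation of `X`** (commuting with the left translations
`λ(x)`, Springer 4.4.3; the infinitesimal right translation): `(D_X p)(g) = d(p ∘ L_g)_1 (X)`, the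
differential at `1` of `x ↦ p (g x)` evaluated on `X`, i.e. the tangent vector `X` at `1`
transported to `g` by `L_g` (Springer 4.4.4: invariant derivations versus tangent vectors at `e`).
[cite: SpringerLAG1998, 4.4.3 and 4.4.4] -/
theorem eval_rDeriv (X : Matrix n n k) (g : GL n k) (p : MvPolynomial (GLCoord n) k) :
    eval (glCoordFun g) (rDeriv X p) = tangentDeriv (aeval (leftMulPolyGL g) p) X := by
  induction p using MvPolynomial.induction_on with
  | C a => rw [rDeriv_C, map_zero, MvPolynomial.aeval_C, MvPolynomial.algebraMap_eq, tangentDeriv_C]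
  | add p q hp hq => rw [map_add, map_add, map_add, tangentDeriv_add, hp, hq]
  | mul_X p c hp =>
    rw [Derivation.leibniz, map_add, smul_eq_mul, smul_eq_mul, map_mul, map_mul, hp, rDeriv_X,
      eval_X, map_mul, MvPolynomial.aeval_X, tangentDeriv_mul, eval_aeval_leftMulPolyGL, mul_one,
      eval_leftMulPolyGL, mul_one, tangentDeriv_leftMulPolyGL]
    ring

variable {G : Subgroup (GL n k)}

/-- **For `X ∈ Lie(G)` the derivation `D_X` maps `𝓘(G)` into itself**: if `p ∈ 𝓘(G)` then
`p ∘ L_g ∈ 𝓘(G)` for `g ∈ G`, so `(D_X p)(g) = d(p ∘ L_g)_1 (X) = 0` (Springer 4.4.7: the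
invariant derivations of `GL_n` preserving the ideal of `G` are those of `G`).
[cite: SpringerLAG1998, 4.4.7] -/
theorem rDeriv_mem_idealGL {X : Matrix n n k} (hX : X ∈ lieAlgebraGL G)
    {p : MvPolynomial (GLCoord n) k} (hp : p ∈ idealGL G) : rDeriv X p ∈ idealGL G := by
  refine mem_idealGL_iff.2 fun g hg => ?_
  rw [eval_rDeriv]
  exact (mem_lieAlgebraGL_iff.1 hX) _ (idealGL_le_comap hg hp)

/-- The iterates `D_X^m`, `X ∈ Lie(G)`, preserve `𝓘(G)`. [folklore] -/
theorem iterate_rDeriv_mem_idealGL {X : Matrix n n k} (hX : X ∈ lieAlgebraGL G) (m : ℕ)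
    {p : MvPolynomial (GLCoord n) k} (hp : p ∈ idealGL G) : (rDeriv X)^[m] p ∈ idealGL G := by
  induction m with
  | zero => exact hp
  | succ m ih => rw [Function.iterate_succ_apply']; exact rDeriv_mem_idealGL hX ih

/-- Translating by `1` does not change differentials at `1`. [folklore] -/
lemma tangentDeriv_aeval_leftMulPolyGL_one (p : MvPolynomial (GLCoord n) k) (X : Matrix n n k) :
    tangentDeriv (aeval (leftMulPolyGL (1 : GL n k)) p) X = tangentDeriv p X := by
  have h : (fun c => aeval (dualPoint X) (leftMulPolyGL (1 : GL n k) c)) = dualPoint X := by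
    funext c
    rw [dualPoint_eq_coordsOf, aeval_leftMulPolyGL_coordsOf, Units.val_one,
      Matrix.map_one _ (map_zero _) (map_one _), one_mul, Matrix.det_one, inv_one, map_one, one_mul]
  rw [tangentDeriv, tangentDeriv, MvPolynomial.aeval_eq_bind₁, MvPolynomial.aeval_bind₁, h]

/-- **`Lie(G) = {X ∈ 𝔤𝔩ₙ | D_X 𝓘(G) ⊆ 𝓘(G)}`**: the Lie algebra of (the closure of) a subgroup
`G ≤ GL_n` consists of the matrices whose invariant derivation preserves the vanishing ideal
of `G` (Springer 4.4.7: for a closed subgroup `H ≤ G` with ideal `J`, `𝒟_{G,H} = {D ∈ 𝒟_G |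
D J ⊆ J}` maps onto `L(H)`; with `G = GL_n`, `L(GL_n) = 𝔤𝔩ₙ` by 4.4.10 (3)). The converse
direction evaluates `D_X p ∈ 𝓘(G)` at `1`. [cite: SpringerLAG1998, 4.4.7 and 4.4.10 (3)] -/
theorem mem_lieAlgebraGL_iff_forall_rDeriv_mem {X : Matrix n n k} :
    X ∈ lieAlgebraGL G ↔ ∀ p ∈ idealGL G, rDeriv X p ∈ idealGL G := by
  refine ⟨fun hX p hp => rDeriv_mem_idealGL hX hp, fun h => mem_lieAlgebraGL_iff.2 fun p hp => ?_⟩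
  have h1 := mem_idealGL_iff.1 (h p hp) 1 G.one_mem
  rwa [eval_rDeriv, tangentDeriv_aeval_leftMulPolyGL_one] at h1

end Derivation

/-! ### `X ↦ D_X` is a homomorphism of Lie algebras -/

section LieHom

omit [DecidableEq n] in
/-- `rDerivVal` is additive in `X`. [folklore] -/
lemma rDerivVal_add (X Y : Matrix n n k) (c : GLCoord n) :
    rDerivVal (X + Y) c = rDerivVal X c + rDerivVal Y c := by
  rcases c with ⟨i, j⟩ | u
  · simp [rDerivVal, mul_add, Finset.sum_add_distrib]
  · simp [rDerivVal, Matrix.trace_add]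
    ring

omit [DecidableEq n] in
/-- `rDerivVal` is homogeneous in `X`. [folklore] -/
lemma rDerivVal_smul (a : k) (X : Matrix n n k) (c : GLCoord n) :
    rDerivVal (a • X) c = a • rDerivVal X c := by
  rcases c with ⟨i, j⟩ | u
  · simp [rDerivVal, Finset.smul_sum, smul_eq_C_mul]
    refine Finset.sum_congr rfl fun l _ => by ring
  · simp [rDerivVal, Matrix.trace_smul, smul_eq_C_mul]
    ring

omit [DecidableEq n] in
/-- `D_{X + Y} = D_X + D_Y`. [folklore] -/
theorem rDeriv_add (X Y : Matrix n n k) : rDeriv (X + Y) = rDeriv X + rDeriv Y :=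
  MvPolynomial.derivation_ext fun c => by simp [rDerivVal_add]

omit [DecidableEq n] in
/-- `D_{a X} = a D_X`. [folklore] -/
theorem rDeriv_smul (a : k) (X : Matrix n n k) : rDeriv (a • X) = a • rDeriv X :=
  MvPolynomial.derivation_ext fun c => by simp [rDerivVal_smul]

omit [DecidableEq n] in
/-- `D_0 = 0`. [folklore] -/
theorem rDeriv_zero : rDeriv (0 : Matrix n n k) = 0 := by
  have h := rDeriv_smul (0 : k) (0 : Matrix n n k)
  rwa [zero_smul, zero_smul] at h

omit [DecidableEq n] in
/-- `D_X (D_Y (x_{ij})) = (x X Y)_{ij}`. [folklore] -/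
lemma rDeriv_rDerivVal_inl (X Y : Matrix n n k) (i j : n) :
    rDeriv X (rDerivVal Y (Sum.inl (i, j))) =
      ∑ m, MvPolynomial.X (Sum.inl (i, m)) * C ((X * Y) m j) := by
  have h : ∀ l, rDeriv X (MvPolynomial.X (Sum.inl (i, l)) * C (Y l j)) =
      C (Y l j) * ∑ m, MvPolynomial.X (Sum.inl (i, m)) * C (X m l) := fun l => by
    rw [Derivation.leibniz, rDeriv_C, smul_zero, zero_add, rDeriv_X, smul_eq_mul]; rfl
  simp only [rDerivVal, map_sum, h, Matrix.mul_apply, Finset.mul_sum, map_mul]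
  rw [Finset.sum_comm]
  refine Finset.sum_congr rfl fun m _ => Finset.sum_congr rfl fun l _ => by ring

omit [DecidableEq n] in
/-- `D_X (D_Y (y)) = tr(X) tr(Y) y`. [folklore] -/
lemma rDeriv_rDerivVal_inr (X Y : Matrix n n k) (u : Unit) :
    rDeriv X (rDerivVal Y (Sum.inr u)) =
      C (Matrix.trace X * Matrix.trace Y) * MvPolynomial.X (Sum.inr u) := by
  simp only [rDerivVal, Derivation.leibniz, rDeriv_C, rDeriv_X, smul_eq_mul, map_mul, map_neg]
  ring

omit [DecidableEq n] in
/-- **`X ↦ D_X` is a Lie algebra homomorphism `𝔤𝔩ₙ → Der k[x, y]`**: `⁅D_X, D_Y⁆ = D_{XY - YX}`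
(Springer 4.4.3: the invariant derivations form a Lie subalgebra of `Der k[G]`; 4.4.10 (3): for
`GL_n` it is `𝔤𝔩ₙ` with bracket `XY - YX` — with our sign convention `D_X ↦ X` is a
homomorphism, with Springer's an anti-homomorphism composed with `X ↦ -X`; here checked on the
generators: `D_X D_Y (x) = x X Y`). [cite: SpringerLAG1998, 4.4.3 and 4.4.10 (3)] -/
theorem rDeriv_commutator (X Y : Matrix n n k) :
    ⁅rDeriv X, rDeriv Y⁆ = rDeriv (X * Y - Y * X) := by
  refine MvPolynomial.derivation_ext fun c => ?_
  rw [Derivation.commutator_apply, rDeriv_X, rDeriv_X, rDeriv_X]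
  rcases c with ⟨i, j⟩ | u
  · rw [rDeriv_rDerivVal_inl, rDeriv_rDerivVal_inl, ← Finset.sum_sub_distrib]
    simp only [rDerivVal, Matrix.sub_apply, map_sub, mul_sub]
  · rw [rDeriv_rDerivVal_inr, rDeriv_rDerivVal_inr, mul_comm (Matrix.trace Y), sub_self]
    rw [rDerivVal, Matrix.trace_sub, Matrix.trace_mul_comm, sub_self, neg_zero, C_0, zero_mul]

end LieHom

/-! ### `D_X` preserves the pieces `k[x, y]_{≤ d}` -/

section Degree

omit [DecidableEq n] in
/-- The values of `D_X` on the coordinates have total degree `≤ 1`. [folklore] -/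
lemma totalDegree_rDerivVal_le (X : Matrix n n k) (c : GLCoord n) :
    (rDerivVal X c).totalDegree ≤ 1 := by
  have hXC : ∀ (v : GLCoord n) (a : k),
      (MvPolynomial.X v * C a : MvPolynomial (GLCoord n) k).totalDegree ≤ 1 := by
    intro v a
    refine (MvPolynomial.totalDegree_mul _ _).trans ?_
    rw [MvPolynomial.totalDegree_X, MvPolynomial.totalDegree_C]
  rcases c with ⟨i, j⟩ | u
  · exact (MvPolynomial.totalDegree_finsetSum_le fun l _ => hXC _ _)
  · rw [rDerivVal, mul_comm]
    exact hXC _ _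

omit [DecidableEq n] in
/-- `D_X` of a monomial of degree `≤ d` has degree `≤ d`. [folklore] -/
lemma rDeriv_monomial_mem_restrictTotalDegree (X : Matrix n n k) {d : ℕ} {m : GLCoord n →₀ ℕ}
    (hm : m.degree ≤ d) (a : k) :
    rDeriv X (monomial m a) ∈ restrictTotalDegree (GLCoord n) k d := by
  rw [rDeriv, mkDerivation_monomial, Finsupp.sum]
  refine Submodule.smul_mem _ _ (Submodule.sum_mem _ fun c hc => ?_)
  rw [mem_restrictTotalDegree, smul_eq_mul]
  refine (totalDegree_mul _ _).trans ?_
  have hc1 : 1 ≤ m c := Nat.one_le_iff_ne_zero.2 (Finsupp.mem_support_iff.1 hc)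
  have hdeg : (m - Finsupp.single c 1).degree + 1 = m.degree := by
    have h := map_add Finsupp.degree (m - Finsupp.single c 1) (Finsupp.single c 1)
    rw [tsub_add_cancel_of_le (Finsupp.single_le_iff.2 hc1), Finsupp.degree_single] at h
    exact h.symm
  calc (monomial (m - Finsupp.single c 1) ((m c : ℕ) : k)).totalDegree + (rDerivVal X c).totalDegree
      ≤ (m - Finsupp.single c 1).degree + 1 :=
        add_le_add (totalDegree_monomial_le _ _) (totalDegree_rDerivVal_le X c)
    _ = m.degree := hdeg
    _ ≤ d := hm

omit [DecidableEq n] in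
/-- **`D_X` does not raise the total degree**: it maps `k[x, y]_{≤ d}` into itself (a derivation
whose values on the generators have degree `≤ 1`; Springer 2.3.6 (i)-style local finiteness for
the infinitesimal right translations). [folklore] -/
theorem rDeriv_mem_restrictTotalDegree (X : Matrix n n k) {d : ℕ} {p : MvPolynomial (GLCoord n) k}
    (hp : p ∈ restrictTotalDegree (GLCoord n) k d) :
    rDeriv X p ∈ restrictTotalDegree (GLCoord n) k d := by
  rw [← support_sum_monomial_coeff p, map_sum]
  refine Submodule.sum_mem _ fun m hm => rDeriv_monomial_mem_restrictTotalDegree X ?_ _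
  rw [mem_restrictTotalDegree] at hp
  exact (le_totalDegree hm).trans hp

omit [DecidableEq n] in
/-- In particular `deg (D_X p) ≤ deg p`. [folklore] -/
theorem totalDegree_rDeriv_le (X : Matrix n n k) (p : MvPolynomial (GLCoord n) k) :
    (rDeriv X p).totalDegree ≤ p.totalDegree :=
  (mem_restrictTotalDegree _ _ _).1
    (rDeriv_mem_restrictTotalDegree X ((mem_restrictTotalDegree _ _ _).2 le_rfl))

end Degree

/-! ### Diagonal matrices act diagonally on monomials -/

section Diagonal

/-- The weight of the coordinate `c` under `D_{diag(s)}`: `x_{ij} ↦ s_j`, `y ↦ -∑ᵢ sᵢ`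
(the infinitesimal version of `diagWeightGL` of `RightTranslationGL.lean`). [folklore] -/
def rDerivWeight (s : n → k) : GLCoord n → k
  | Sum.inl ij => s ij.2
  | Sum.inr _ => - ∑ i, s i

/-- On coordinates `D_{diag(s)}` is the scaling `x_c ↦ w(c) x_c`. [folklore] -/
lemma rDerivVal_diagonal (s : n → k) (c : GLCoord n) :
    rDerivVal (Matrix.diagonal s) c = C (rDerivWeight s c) * MvPolynomial.X c := by
  rcases c with ⟨i, j⟩ | u
  · simp only [rDerivVal, Matrix.diagonal_apply, rDerivWeight]
    rw [Finset.sum_eq_single j]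
    · simp [mul_comm]
    · intro l _ hl
      simp [hl]
    · intro h
      exact absurd (Finset.mem_univ j) h
  · simp [rDerivVal, rDerivWeight, Matrix.trace_diagonal]

/-- **The monomials are eigenvectors of `D_{diag(s)}`**, with eigenvalue `∑_c m_c w(c)`
(Springer 4.4.10 (3) / 3.2.2, infinitesimally: the weights of the diagonal torus on `k[GL_n]`).
[folklore] -/
theorem rDeriv_diagonal_monomial (s : n → k) (m : GLCoord n →₀ ℕ) (a : k) :
    rDeriv (Matrix.diagonal s) (monomial m a) =
      (m.sum fun c e => (e : k) * rDerivWeight s c) • monomial m a := by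
  rw [rDeriv, mkDerivation_monomial, Finsupp.sum, Finsupp.sum, Finset.sum_smul, Finset.smul_sum]
  refine Finset.sum_congr rfl fun c hc => ?_
  have hc1 : 1 ≤ m c := Nat.one_le_iff_ne_zero.2 (Finsupp.mem_support_iff.1 hc)
  rw [rDerivVal_diagonal, smul_eq_mul, C_mul_X_eq_monomial, monomial_mul,
    tsub_add_cancel_of_le (Finsupp.single_le_iff.2 hc1), smul_monomial, smul_monomial, smul_eq_mul,
    smul_eq_mul]
  congr 1
  ring

end Diagonal

end Literature.NumberTheory.Automorphic
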